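import Mathlib.Data.Nat.Choose.Central
import Mathlib.Data.Nat.Choose.Sum
import Mathlib.Data.Finset.Powerset
import Mathlib.Data.Fintype.Powerset
import Mathlib.Algebra.Order.BigOperators.Group.Finset
import Mathlib.Analysis.SpecialFunctions.Sqrt
import Literature.Probability.LatticeModels.UniformStepWalk
import HarnessLib

/-!
# Random balanced cuts are simultaneously unbalanced on disjoint sets
(counting form of Raz 2006, Prop. 4.1 / §4, for the log-product route to multilinear formula
lower bounds)

Support file for the partial-derivative-matrix method (`FullRankMultilinear*.lean`). Raz's
lower bound for multilinear formulas [Raz2006, §3–§4] rests on one probabilistic fact: under a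
random partition of the variables, the number of `Y`-variables falling into a fixed set `X_v` of
size `≥ N^{1/2}` is hypergeometric and "takes any specific value with probability of at most
`O(N^{-1/4})`" [Raz2006, Prop. 4.1], and along a path of `Ω(log n)` nodes these events are
nearly independent [Raz2006, §4, proof of Lemma 3.4]. In the log-product presentation of the
same argument the sets are pairwise DISJOINT, and then the simultaneous statement has an exact
counting proof with no conditioning, which is what we record:

* `card_filter_inter_le` — for pairwise disjoint `X_j ⊆ G` (`j ∈ J`) and arbitrary sets `W_j`
  of admissible intersection sizes, the number of `Y ⊆ G` with `|Y ∩ X_j| ∈ W_j` for all `j` is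
  `≤ 2^{|G| - Σ_j |X_j|} · ∏_j #{T ⊆ X_j : |T| ∈ W_j}` (in fact equality; induction on `J`,
  splitting `Y ↦ (Y ∩ X_j, Y ∖ X_j)`);
* `card_windows_le` — `#{T ⊆ X : |T| ∈ W} ≤ |W| · C(|X|, ⌊|X|/2⌋)` (`Nat.choose_le_middle`);
* `choose_middle_div_two_pow_le` — `C(x,⌊x/2⌋)/2^x ≤ 1/√(x+1)`, from the tree's elementary
  central-binomial bound `C(x, ⌊x/2⌋)² (x+1) ≤ 4^x`
  (`Literature.Probability.LatticeModels.UniformStep.choose_half_sq_mul_succ_le`);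
* `card_balanced_windows_le` — consequently, among the `C(2u,u)` BALANCED cuts `Y` of a
  `2u`-set, the fraction with `| |Y ∩ X_j| - c_j | ≤ D` for every `j` (any centres `c_j`) is at
  most `2u · ∏_j (2D+1)/√(|X_j|+1)` (`4^u ≤ 2u · C(2u,u)`,
  `Nat.four_pow_le_two_mul_self_mul_centralBinom`): the `∏_j O(|X_j|^{-1/2})` decay that drives
  the `n^{-Ω(log n)}` of [Raz2006, Lemma 3.4].

## References
* [Raz2006] R. Raz, *Separation of multilinear circuit and formula size*, Theory of Computing 2
  (2006) 121–135, §3.3 (random partition), Prop. 4.1, §4 (proof of Lemma 3.4).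
-/

namespace Literature.Barriers.ValiantsHypothesis.RazCut

open Finset

/-! ### Counting subsets with prescribed intersections with disjoint sets -/

section Counting

variable {α ι : Type*} [DecidableEq α] [DecidableEq ι]

/-- **Exact product count.** For pairwise disjoint `X_j ⊆ G` (`j ∈ J`) and sets `W_j ⊆ ℕ` of
admissible intersection sizes, the number of `Y ⊆ G` with `|Y ∩ X_j| ∈ W_j` for every `j ∈ J` is
at most `2^{|G| - Σ_j |X_j|} · ∏_{j ∈ J} #{T ⊆ X_j : |T| ∈ W_j}` (the events for disjoint sets
are independent under a uniformly random subset). [cite: Raz2006, §4 (proof of Lemma 3.4)] -/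
theorem card_filter_inter_le (J : Finset ι) (X : ι → Finset α) (W : ι → Finset ℕ) :
    ∀ G : Finset α, (∀ j ∈ J, X j ⊆ G) → (J : Set ι).PairwiseDisjoint X →
      ((G.powerset.filter fun Y => ∀ j ∈ J, (Y ∩ X j).card ∈ W j).card ≤
        2 ^ (G.card - ∑ j ∈ J, (X j).card) *
          ∏ j ∈ J, ((X j).powerset.filter fun T => T.card ∈ W j).card) := by
  induction J using Finset.induction_on with
  | empty =>
    intro G _ _
    simp [Finset.card_powerset]
  | insert j₀ J hj₀ ih =>
    intro G hG hdisj
    have hX₀G : X j₀ ⊆ G := hG j₀ (mem_insert_self _ _)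
    have hdisj' : (J : Set ι).PairwiseDisjoint X :=
      hdisj.subset (by simp [Finset.coe_insert, Set.subset_insert])
    have hdj : ∀ j ∈ J, Disjoint (X j₀) (X j) := fun j hj =>
      hdisj (by simp) (by simp [hj]) (fun h => hj₀ (h ▸ hj))
    -- the sets `X j`, `j ∈ J`, lie in the smaller ground set `G \ X j₀`
    have hG' : ∀ j ∈ J, X j ⊆ G \ X j₀ := fun j hj =>
      Finset.subset_sdiff.2 ⟨hG j (mem_insert_of_mem hj), (hdj j hj).symm⟩
    have hIH := ih (G \ X j₀) hG' hdisj'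
    -- split `Y ↦ (Y ∩ X j₀, Y \ X j₀)`
    set A := (X j₀).powerset.filter fun T => T.card ∈ W j₀ with hA
    set B := (G \ X j₀).powerset.filter fun Y => ∀ j ∈ J, (Y ∩ X j).card ∈ W j with hB
    set S := G.powerset.filter (fun Y => ∀ j ∈ insert j₀ J, (Y ∩ X j).card ∈ W j) with hS
    have hmap : ∀ Y ∈ S, (Y ∩ X j₀, Y \ X j₀) ∈ A ×ˢ B := by
      intro Y hY
      rw [hS, mem_filter, mem_powerset] at hY
      obtain ⟨hYG, hW⟩ := hY
      refine mem_product.2 ⟨?_, ?_⟩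
      · rw [hA, mem_filter, mem_powerset]
        exact ⟨inter_subset_right, hW j₀ (mem_insert_self _ _)⟩
      · rw [hB, mem_filter, mem_powerset]
        refine ⟨sdiff_subset_sdiff hYG le_rfl, fun j hj => ?_⟩
        have heq : Y \ X j₀ ∩ X j = Y ∩ X j := by
          ext a
          simp only [mem_inter, mem_sdiff]
          constructor
          · rintro ⟨⟨h1, -⟩, h2⟩; exact ⟨h1, h2⟩
          · rintro ⟨h1, h2⟩
            exact ⟨⟨h1, fun h0 => disjoint_left.1 (hdj j hj) h0 h2⟩, h2⟩
        rw [heq]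
        exact hW j (mem_insert_of_mem hj)
    have hinj : Set.InjOn (fun Y : Finset α => (Y ∩ X j₀, Y \ X j₀)) ↑S := by
      intro Y _ Y' _ h
      simp only [Prod.mk.injEq] at h
      rw [← sdiff_union_inter Y (X j₀), ← sdiff_union_inter Y' (X j₀), h.1, h.2]
    have hcard : S.card ≤ A.card * B.card := by
      rw [← card_product]
      exact card_le_card_of_injOn _ hmap hinj
    -- bookkeeping
    have hsum : ∑ j ∈ insert j₀ J, (X j).card = (X j₀).card + ∑ j ∈ J, (X j).card :=
      sum_insert hj₀
    have hsd : (G \ X j₀).card = G.card - (X j₀).card := card_sdiff_of_subset hX₀G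
    rw [prod_insert hj₀, hsum, ← Nat.sub_sub, ← hsd]
    calc S.card ≤ A.card * B.card := hcard
      _ ≤ A.card * (2 ^ ((G \ X j₀).card - ∑ j ∈ J, (X j).card) *
            ∏ j ∈ J, ((X j).powerset.filter fun T => T.card ∈ W j).card) :=
          Nat.mul_le_mul_left _ hIH
      _ = _ := by ring

/-- **Windows.** The number of subsets of `X` whose size lies in `W` is at most
`|W| · C(|X|, ⌊|X|/2⌋)` (every level of the Boolean lattice is at most the middle one).
[cite: Raz2006, Prop. 4.1] -/
theorem card_windows_le (X : Finset α) (W : Finset ℕ) :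
    ((X.powerset.filter fun T => T.card ∈ W).card) ≤ W.card * X.card.choose (X.card / 2) := by
  have hsub : (X.powerset.filter fun T => T.card ∈ W) ⊆ W.biUnion fun t => X.powersetCard t := by
    intro T hT
    rw [mem_filter, mem_powerset] at hT
    exact mem_biUnion.2 ⟨T.card, hT.2, mem_powersetCard.2 ⟨hT.1, rfl⟩⟩
  calc ((X.powerset.filter fun T => T.card ∈ W).card)
      ≤ (W.biUnion fun t => X.powersetCard t).card := card_le_card hsub
    _ ≤ ∑ t ∈ W, (X.powersetCard t).card := card_biUnion_le
    _ ≤ ∑ _t ∈ W, X.card.choose (X.card / 2) :=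
        sum_le_sum fun t _ => by rw [card_powersetCard]; exact Nat.choose_le_middle _ _
    _ = W.card * X.card.choose (X.card / 2) := by rw [sum_const, smul_eq_mul]

/-- **Symmetric windows around any centre have `≤ 2D+1` integer points**: the set of `t ≤ x`
with `|t - c| ≤ D` (in `ℝ`) has at most `2D + 1` elements. [folklore] -/
private theorem card_window_abs_le (x D : ℕ) (c : ℝ) :
    ((Finset.range (x + 1)).filter fun t : ℕ => |(t : ℝ) - c| ≤ D).card ≤ 2 * D + 1 := by
  set F := (Finset.range (x + 1)).filter fun t : ℕ => |(t : ℝ) - c| ≤ D with hF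
  by_cases hne : F.Nonempty
  · -- all members lie in an interval of length `2D` starting at the minimum
    obtain ⟨t₀, ht₀⟩ := hne
    set m := F.min' ⟨t₀, ht₀⟩ with hm
    have hmF : m ∈ F := min'_mem _ _
    have hmc : |(m : ℝ) - c| ≤ D := (mem_filter.1 hmF).2
    have hsub : F ⊆ Finset.Icc m (m + 2 * D) := by
      intro t ht
      have htc : |(t : ℝ) - c| ≤ D := (mem_filter.1 ht).2
      have hmt : m ≤ t := min'_le _ _ ht
      rw [mem_Icc]
      refine ⟨hmt, ?_⟩
      have h1 : ((t : ℝ)) - m ≤ 2 * D := by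
        have := abs_le.1 htc
        have := abs_le.1 hmc
        linarith
      have h2 : ((t - m : ℕ) : ℝ) ≤ ((2 * D : ℕ) : ℝ) := by push_cast [hmt]; linarith
      have h3 : t - m ≤ 2 * D := by exact_mod_cast h2
      omega
    calc F.card ≤ (Finset.Icc m (m + 2 * D)).card := card_le_card hsub
      _ = 2 * D + 1 := by rw [Nat.card_Icc]; omega
  · rw [not_nonempty_iff_eq_empty] at hne
    rw [hne, card_empty]
    exact Nat.zero_le _

end Counting

/-! ### The middle binomial coefficient: `C(x, ⌊x/2⌋)/2^x ≤ 1/√(x+1)` -/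

section Central

/-- Real form of the same estimate: `C(x, ⌊x/2⌋) / 2^x ≤ 1 / √(x + 1)` (point probabilities of
a symmetric binomial / of the middle layer). [cite: Raz2006, Prop. 4.1 (proof)] -/
theorem choose_middle_div_two_pow_le (x : ℕ) :
    (x.choose (x / 2) : ℝ) / 2 ^ x ≤ 1 / Real.sqrt (x + 1) := by
  have hsq : Real.sqrt ((x : ℝ) + 1) > 0 := Real.sqrt_pos.2 (by positivity)
  rw [div_le_div_iff₀ (by positivity) hsq, one_mul]
  -- square both sides
  have h : ((x.choose (x / 2) : ℝ) * Real.sqrt (x + 1)) ^ 2 ≤ ((2 : ℝ) ^ x) ^ 2 := by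
    rw [mul_pow, Real.sq_sqrt (by positivity), ← pow_mul, show ((2:ℝ) ^ (x * 2)) = 4 ^ x by
      rw [mul_comm, pow_mul]; norm_num]
    exact_mod_cast Literature.Probability.LatticeModels.UniformStep.choose_half_sq_mul_succ_le x
  have h0 : (0 : ℝ) ≤ (x.choose (x / 2) : ℝ) * Real.sqrt (x + 1) := by positivity
  exact (pow_le_pow_iff_left₀ h0 (by positivity) two_ne_zero).1 h

end Central

/-! ### Balanced cuts -/

section Balanced

variable {α ι : Type*} [DecidableEq α] [DecidableEq ι] [Fintype α]

/-- **Simultaneous anti-concentration of a random balanced cut on disjoint sets** (the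
probabilistic core of [Raz2006, Lemma 3.4] in the log-product form). Let `|α| = 2u`, `u ≥ 1`,
let `X_j` (`j ∈ J`) be pairwise disjoint, `c_j ∈ ℝ` arbitrary centres and `D ∈ ℕ`. Then the number
of balanced `Y` (`|Y| = u`) with `| |Y ∩ X_j| - c_j | ≤ D` for every `j ∈ J` is at most
`2u · C(2u, u) · ∏_j (2D+1)/√(|X_j|+1)`, i.e. a uniformly random balanced cut satisfies all these
near-balance conditions with probability `≤ 2u ∏_j (2D+1)/√(|X_j|+1)`.
[cite: Raz2006, Prop. 4.1 and §4 (proof of Lemma 3.4)] -/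
theorem card_balanced_windows_le {u : ℕ} (hu : 1 ≤ u) (hα : Fintype.card α = 2 * u)
    (J : Finset ι) (X : ι → Finset α) (hdisj : (J : Set ι).PairwiseDisjoint X)
    (c : ι → ℝ) (D : ℕ) :
    ((((univ : Finset α).powersetCard u).filter fun Y =>
        ∀ j ∈ J, |((Y ∩ X j).card : ℝ) - c j| ≤ D).card : ℝ) ≤
      2 * u * (2 * u).choose u * ∏ j ∈ J, ((2 * D + 1 : ℝ) / Real.sqrt ((X j).card + 1)) := by
  classical
  -- windows `W_j = {t ≤ |X_j| : |t - c_j| ≤ D}`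
  set W : ι → Finset ℕ := fun j =>
    (Finset.range ((X j).card + 1)).filter fun t : ℕ => |(t : ℝ) - c j| ≤ D with hW
  -- (1) balanced bad cuts ⊆ all bad subsets of `univ`
  have hsub : (((univ : Finset α).powersetCard u).filter fun Y =>
        ∀ j ∈ J, |((Y ∩ X j).card : ℝ) - c j| ≤ D) ⊆
      ((univ : Finset α).powerset.filter fun Y => ∀ j ∈ J, (Y ∩ X j).card ∈ W j) := by
    intro Y hY
    rw [mem_filter, mem_powersetCard] at hY
    rw [mem_filter, mem_powerset]
    refine ⟨hY.1.1, fun j hj => ?_⟩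
    rw [hW, mem_filter, Finset.mem_range]
    exact ⟨Nat.lt_succ_of_le (card_le_card inter_subset_right), hY.2 j hj⟩
  -- (2) the product count
  have hcount := card_filter_inter_le J X W univ (fun j _ => subset_univ _) hdisj
  have hsumle : ∑ j ∈ J, (X j).card ≤ (univ : Finset α).card := by
    rw [← card_biUnion hdisj]
    exact card_le_card (subset_univ _)
  have hcardu : (univ : Finset α).card = 2 * u := by rw [card_univ, hα]
  -- (3) each window count `≤ (2D+1) C(x_j, x_j/2) ≤ (2D+1) 2^{x_j} / √(x_j+1)`
  have hwin : ∀ j ∈ J, ((((X j).powerset.filter fun T => T.card ∈ W j).card : ℕ) : ℝ) ≤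
      (2 * D + 1) * (2 : ℝ) ^ (X j).card / Real.sqrt ((X j).card + 1) := by
    intro j _
    have h1 := card_windows_le (X j) (W j)
    have h2 : (W j).card ≤ 2 * D + 1 := card_window_abs_le _ D (c j)
    have h3 := choose_middle_div_two_pow_le (X j).card
    have hsq : 0 < Real.sqrt (((X j).card : ℝ) + 1) := Real.sqrt_pos.2 (by positivity)
    have h4 : ((X j).card.choose ((X j).card / 2) : ℝ) ≤ 2 ^ (X j).card / Real.sqrt ((X j).card + 1) := by
      rw [div_le_iff₀ (by positivity)] at h3
      calc ((X j).card.choose ((X j).card / 2) : ℝ) ≤ 1 / Real.sqrt ((X j).card + 1) * 2 ^ (X j).card := h3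
        _ = 2 ^ (X j).card / Real.sqrt ((X j).card + 1) := by ring
    calc ((((X j).powerset.filter fun T => T.card ∈ W j).card : ℕ) : ℝ)
        ≤ ((W j).card : ℝ) * ((X j).card.choose ((X j).card / 2) : ℝ) := by exact_mod_cast h1
      _ ≤ (2 * D + 1) * (2 ^ (X j).card / Real.sqrt ((X j).card + 1)) := by
          gcongr
          exact_mod_cast h2
      _ = _ := by ring
  -- (4) assemble: `#bad ≤ 2^{2u - Σ x_j} ∏ (2D+1) 2^{x_j}/√(x_j+1) = 4^u ∏ (2D+1)/√(x_j+1)`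
  have hprod : (∏ j ∈ J, ((((X j).powerset.filter fun T => T.card ∈ W j).card : ℕ) : ℝ)) ≤
      ∏ j ∈ J, ((2 * D + 1) * (2 : ℝ) ^ (X j).card / Real.sqrt ((X j).card + 1)) :=
    prod_le_prod (fun j _ => by positivity) hwin
  have hsplit : ∏ j ∈ J, ((2 * D + 1) * (2 : ℝ) ^ (X j).card / Real.sqrt ((X j).card + 1)) =
      (2 : ℝ) ^ (∑ j ∈ J, (X j).card) * ∏ j ∈ J, ((2 * D + 1 : ℝ) / Real.sqrt ((X j).card + 1)) := by
    rw [← prod_pow_eq_pow_sum, ← prod_mul_distrib]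
    exact prod_congr rfl fun j _ => by ring
  have h4u : (4 : ℝ) ^ u ≤ 2 * u * (2 * u).choose u := by
    have := Nat.four_pow_le_two_mul_self_mul_centralBinom u hu
    rw [Nat.centralBinom_eq_two_mul_choose] at this
    exact_mod_cast this
  have hpow : (2 : ℝ) ^ ((univ : Finset α).card - ∑ j ∈ J, (X j).card) * 2 ^ (∑ j ∈ J, (X j).card)
      = 4 ^ u := by
    rw [← pow_add, Nat.sub_add_cancel hsumle, hcardu, pow_mul]; norm_num
  calc ((((univ : Finset α).powersetCard u).filter fun Y =>
          ∀ j ∈ J, |((Y ∩ X j).card : ℝ) - c j| ≤ D).card : ℝ)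
      ≤ (((univ : Finset α).powerset.filter fun Y => ∀ j ∈ J, (Y ∩ X j).card ∈ W j).card : ℝ) := by
          exact_mod_cast card_le_card hsub
    _ ≤ (2 : ℝ) ^ ((univ : Finset α).card - ∑ j ∈ J, (X j).card) *
          ∏ j ∈ J, ((((X j).powerset.filter fun T => T.card ∈ W j).card : ℕ) : ℝ) := by
          exact_mod_cast hcount
    _ ≤ (2 : ℝ) ^ ((univ : Finset α).card - ∑ j ∈ J, (X j).card) *
          ∏ j ∈ J, ((2 * D + 1) * (2 : ℝ) ^ (X j).card / Real.sqrt ((X j).card + 1)) :=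
          mul_le_mul_of_nonneg_left hprod (by positivity)
    _ = 4 ^ u * ∏ j ∈ J, ((2 * D + 1 : ℝ) / Real.sqrt ((X j).card + 1)) := by
          rw [hsplit, ← mul_assoc, hpow]
    _ ≤ 2 * u * (2 * u).choose u * ∏ j ∈ J, ((2 * D + 1 : ℝ) / Real.sqrt ((X j).card + 1)) :=
          mul_le_mul_of_nonneg_right h4u (prod_nonneg fun j _ => by positivity)

end Balanced

end Literature.Barriers.ValiantsHypothesis.RazCut
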